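import Summits.Ventures.LatticeQCDFlow.Scaling.ReplicaExchangeModeGap

/-!
HONEST FRAMING: exact (Metropolis-corrected) sampling algorithms for lattice gauge theory; figures
of merit are autocorrelation/cost numbers at stated couplings and volumes; no continuum-physics
claim.

# ReplicaExchangeModeOverlap — THE ASSIGNMENT-RESTRICTED SWAP OVERLAP FROM ONE-LEVEL DATA: chapter Y's mode-restricted
# overlaps `δ` (`δ·min{μ_l(A_j), μ_{l+1}(A_j)} ≤ Σ_{A_j} min{μ_l, μ_{l+1}}`), persistence `p` and cooling `q` give
# `δ₂ = δ²pq`, hence `Gap(ptBareSampler ½ μ M) ≥ p q^K γ_A·min{δ²pq/K², γ₀/(K+1)}/(96(K+1)²)` (lean-2 GEN-18, ours)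

Venture-side (OURS).  Cell `lqcd-flow` (pub-lqcd), unit `pub-lqcd-lean-2-g18`, 2026-08-25.  Chapter R, file 5.  The
gap theorem `Scaling/ReplicaExchangeModeGap.ptBareModeHalf_spectralGap_ge` asks for the assignment-restricted swap
overlap `δ₂·min{π̄(m), π̄(m∘σ_l)} ≤ Σ_{mode∘x = m} min{π̃(x), π̃(x∘σ_l)}` — a statement about pairs of whole replica
configurations.  Here it is reduced to the SAME one-level hypothesis chapter Y uses for simulated tempering
(`Scaling/SimulatedTemperingModeGap`: `hδ`), by the pointwise inequality
`min{μ_l(a)μ_{l+1}(b), μ_l(b)μ_{l+1}(a)} ≥ min{μ_l(a), μ_{l+1}(a)}·min{μ_l(b), μ_{l+1}(b)}` and the product structure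
of the block (a pure tensor, summed by `sum_tensorFun`); the two marginal factors are then compared with the mode
masses by `δ`, `p` (one heating step) and `q` (one cooling step).

## What is proved

* §1 **`min_tensorFun_swap_ge`** — `min{π̃(x), π̃(x∘σ_l)} ≥ ⊗_k ψ_k(x_k)` with `ψ_k = μ_k` off the pair and
  `ψ_l = ψ_{l+1} = min{μ_l, μ_{l+1}}` on it; **`ptBareMode_hδ_of_overlap`** — `hδ` of chapter R with `δ₂ = δ²pq`.
* §2 **`ptBareModeHalf_spectralGap_ge_of_overlap`** — `Gap ≥ p q^K γ_A·min{δ²pq/K², γ₀/(K+1)}/(96(K+1)²)` at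
  `t = ½` from chapter Y's data `γ_A, γ₀, δ, p` plus `q` (the `τ_int` ceiling follows as in
  `Scaling/ReplicaExchangeModeGap.ptBareModeHalf_tauInt_le`).

NOT CLAIMED: sharpness (`δ₂` can be much larger than `δ²pq`); anything measured.  Literature grade (cell rule):
ELEMENTARY, NEW TYPING; nothing cited as a fact; no new bib keys.
-/

noncomputable section

open Finset Function
open Literature.Probability.MarkovChains
open Literature.Probability.MarkovChains.Decomposition

namespace Summit.Ventures.LatticeQCDFlow.Scaling

section Overlap

variable {S J : Type*} [Fintype S] [DecidableEq S] [Fintype J] [DecidableEq J] {K : ℕ}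
  {μ : Fin (K + 1) → S → ℝ} {mode : S → J}

/-! ## §1 The assignment-restricted overlap from one-level overlaps -/

omit [Fintype S] [DecidableEq S] [Fintype J] [DecidableEq J] in
/-- **Both a configuration and its swap dominate one pure tensor:** with `ψ_k = μ_k` for `k ∉ {l, l+1}` and
`ψ_l = ψ_{l+1} = min{μ_l, μ_{l+1}}`, `⊗ψ(x) ≤ min{π̃(x), π̃(x∘σ_l)}` (`μ ≥ 0`). [ours] -/
theorem min_tensorFun_swap_ge (hμ0 : ∀ k x, 0 ≤ μ k x) (x : Fin (K + 1) → S) (l : Fin K) :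
    tensorFun (fun k u => if k = l.castSucc ∨ k = l.succ then min (μ l.castSucc u) (μ l.succ u) else μ k u) x
      ≤ min (tensorFun μ x) (tensorFun μ (x ∘ levelSwap l)) := by
  set ψ : Fin (K + 1) → S → ℝ :=
    fun k u => if k = l.castSucc ∨ k = l.succ then min (μ l.castSucc u) (μ l.succ u) else μ k u with hψ
  have hcs : l.castSucc ≠ l.succ := fun e => by have := congrArg Fin.val e; simp at this
  have hψ0 : ∀ k u, 0 ≤ ψ k u := fun k u => by
    rw [hψ]; beta_reduce; split_ifs
    · exact le_min (hμ0 _ _) (hμ0 _ _)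
    · exact hμ0 _ _
  refine le_min ?_ ?_
  · -- `⊗ψ ≤ π̃(x)` factor by factor
    unfold tensorFun
    refine prod_le_prod (fun k _ => hψ0 k _) fun k _ => ?_
    rw [hψ]; beta_reduce
    split_ifs with h
    · rcases h with h | h
      · subst h; exact min_le_left _ _
      · subst h; exact min_le_right _ _
    · exact le_rfl
  · -- `⊗ψ ≤ π̃(x∘σ_l)`: reindex the product along the swap
    have hre : tensorFun μ (x ∘ levelSwap l) = ∏ k, μ (levelSwap l k) (x k) := by
      unfold tensorFun
      have h := Equiv.prod_comp (levelSwap l) (fun k => μ (levelSwap l k) (x k))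
      -- `Π_k μ_{σ(σk)}(x_{σk}) = Π_k μ_{σk}(x_k)`; and `σ(σk) = k`
      have hinv : ∀ k, levelSwap l (levelSwap l k) = k := fun k => by
        unfold levelSwap; exact Equiv.swap_apply_self _ _ _
      simp only [Function.comp_apply] at h ⊢
      rw [← h]
      exact prod_congr rfl fun k _ => by rw [hinv]
    rw [hre]
    unfold tensorFun
    refine prod_le_prod (fun k _ => hψ0 k _) fun k _ => ?_
    rw [hψ]; beta_reduce
    by_cases h1 : k = l.castSucc
    · subst h1
      rw [if_pos (Or.inl rfl), levelSwap_castSucc]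
      exact min_le_right _ _
    · by_cases h2 : k = l.succ
      · subst h2
        rw [if_pos (Or.inr rfl)]
        have e : levelSwap l l.succ = l.castSucc := by unfold levelSwap; exact Equiv.swap_apply_right _ _
        rw [e]
        exact min_le_left _ _
      · rw [if_neg (not_or.mpr ⟨h1, h2⟩)]
        have e : levelSwap l k = k := by unfold levelSwap; exact Equiv.swap_apply_of_ne_of_ne h1 h2
        rw [e]

omit [DecidableEq S] [Fintype J] in
/-- **`hδ` OF CHAPTER R FROM CHAPTER Y'S ONE-LEVEL OVERLAPS:** if `δ·min{μ_l(A_j), μ_{l+1}(A_j)} ≤ Σ_{A_j}min{μ_l, μ_{l+1}}`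
for every mode `j` and pair `l`, `p·μ_{l+1}(A_j) ≤ μ_l(A_j)` (one heating step) and `q·μ_l(A_j) ≤ μ_{l+1}(A_j)` (one
cooling step), then for every assignment `m`:
`δ²pq·min{π̄(m), π̄(m∘σ_l)} ≤ Σ_{mode∘x = m} min{π̃(x), π̃(x∘σ_l)}`. [ours] -/
theorem ptBareMode_hδ_of_overlap (hμ0 : ∀ k x, 0 ≤ μ k x) {δ p q : ℝ} (hδ0 : 0 ≤ δ) (hp0 : 0 ≤ p) (hp1 : p ≤ 1)
    (hq0 : 0 ≤ q) (hq1 : q ≤ 1)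
    (hδ : ∀ (l : Fin K) (j : J), δ * min (blockMass (μ l.castSucc) mode j) (blockMass (μ l.succ) mode j)
      ≤ ∑ x ∈ block mode j, min (μ l.castSucc x) (μ l.succ x))
    (hpers1 : ∀ (l : Fin K) (j : J), p * blockMass (μ l.succ) mode j ≤ blockMass (μ l.castSucc) mode j)
    (hq : ∀ (l : Fin K) (j : J), q * blockMass (μ l.castSucc) mode j ≤ blockMass (μ l.succ) mode j)
    (m : Fin (K + 1) → J) (l : Fin K) :
    δ ^ 2 * p * q * min (blockMass (tensorFun μ) (fun z : Fin (K + 1) → S => mode ∘ z) m)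
        (blockMass (tensorFun μ) (fun z : Fin (K + 1) → S => mode ∘ z) (m ∘ levelSwap l))
      ≤ ∑ x ∈ block (fun z : Fin (K + 1) → S => mode ∘ z) m, min (tensorFun μ x) (tensorFun μ (x ∘ levelSwap l)) := by
  have hcs : l.castSucc ≠ l.succ := fun e => by have := congrArg Fin.val e; simp at this
  set ψ : Fin (K + 1) → S → ℝ :=
    fun k u => if k = l.castSucc ∨ k = l.succ then min (μ l.castSucc u) (μ l.succ u) else μ k u with hψ
  set ν : Fin (K + 1) → J → ℝ := fun k => blockMass (μ k) mode with hν
  have hν0 : ∀ k j, 0 ≤ ν k j := fun k j => blockMass_nonneg (hμ0 k) mode j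
  -- Step 1: the block sum of the pure tensor, by `sum_tensorFun`
  have S1 : ∑ x ∈ block (fun z : Fin (K + 1) → S => mode ∘ z) m, tensorFun ψ x
      = ∏ k, ∑ u ∈ block mode (m k), ψ k u := by
    unfold block
    rw [sum_filter]
    simp_rw [tensorFun_modeIndicator (μ := ψ) m, sum_tensorFun]
    refine prod_congr rfl fun k _ => ?_
    rw [sum_filter]
  -- Step 2: each factor against the mode mass
  set d : Fin (K + 1) → ℝ := fun k => (if k = l.castSucc then δ * q else 1) * (if k = l.succ then δ * p else 1)
    with hd
  have hprodd : ∏ k, d k = δ ^ 2 * p * q := by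
    rw [hd, prod_mul_distrib, prod_ite_eq', prod_ite_eq']
    simp only [mem_univ, if_true]
    ring
  have S2 : ∀ k, d k * ν k (m k) ≤ ∑ u ∈ block mode (m k), ψ k u := by
    intro k
    by_cases h1 : k = l.castSucc
    · subst h1
      have e : ∀ u, ψ l.castSucc u = min (μ l.castSucc u) (μ l.succ u) := fun u => by
        rw [hψ]; beta_reduce; rw [if_pos (Or.inl rfl)]
      simp_rw [e]
      rw [hd]; simp only [if_true, if_neg hcs, mul_one]
      -- `δq·ν_l(j) ≤ δ·min{ν_l(j), ν_{l+1}(j)} ≤ overlap`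
      have hmin : q * ν l.castSucc (m l.castSucc) ≤ min (ν l.castSucc (m l.castSucc)) (ν l.succ (m l.castSucc)) :=
        le_min ((mul_le_of_le_one_left (hν0 _ _) hq1)) (hq l (m l.castSucc))
      calc δ * q * ν l.castSucc (m l.castSucc) = δ * (q * ν l.castSucc (m l.castSucc)) := by ring
        _ ≤ δ * min (ν l.castSucc (m l.castSucc)) (ν l.succ (m l.castSucc)) := mul_le_mul_of_nonneg_left hmin hδ0
        _ ≤ _ := hδ l (m l.castSucc)
    · by_cases h2 : k = l.succ
      · subst h2
        have e : ∀ u, ψ l.succ u = min (μ l.castSucc u) (μ l.succ u) := fun u => by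
          rw [hψ]; beta_reduce; rw [if_pos (Or.inr rfl)]
        simp_rw [e]
        rw [hd]; simp only [if_neg (Ne.symm hcs), if_true, one_mul]
        have hmin : p * ν l.succ (m l.succ) ≤ min (ν l.castSucc (m l.succ)) (ν l.succ (m l.succ)) :=
          le_min (hpers1 l (m l.succ)) (mul_le_of_le_one_left (hν0 _ _) hp1)
        calc δ * p * ν l.succ (m l.succ) = δ * (p * ν l.succ (m l.succ)) := by ring
          _ ≤ δ * min (ν l.castSucc (m l.succ)) (ν l.succ (m l.succ)) := mul_le_mul_of_nonneg_left hmin hδ0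
          _ ≤ _ := hδ l (m l.succ)
      · have e : ∀ u, ψ k u = μ k u := fun u => by
          rw [hψ]; beta_reduce; rw [if_neg (not_or.mpr ⟨h1, h2⟩)]
        simp_rw [e]
        rw [hd]; simp only [if_neg h1, if_neg h2, one_mul]
        exact le_of_eq rfl
  -- assembly
  calc δ ^ 2 * p * q * min (blockMass (tensorFun μ) (fun z : Fin (K + 1) → S => mode ∘ z) m)
        (blockMass (tensorFun μ) (fun z : Fin (K + 1) → S => mode ∘ z) (m ∘ levelSwap l))
      ≤ δ ^ 2 * p * q * blockMass (tensorFun μ) (fun z : Fin (K + 1) → S => mode ∘ z) m :=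
        mul_le_mul_of_nonneg_left (min_le_left _ _) (by positivity)
    _ = ∏ k, d k * ν k (m k) := by
        rw [ptBareMode_blockMass, prod_mul_distrib, hprodd]; rfl
    _ ≤ ∏ k, ∑ u ∈ block mode (m k), ψ k u :=
        prod_le_prod (fun k _ => mul_nonneg (by rw [hd]; positivity) (hν0 _ _)) fun k _ => S2 k
    _ = ∑ x ∈ block (fun z : Fin (K + 1) → S => mode ∘ z) m, tensorFun ψ x := S1.symm
    _ ≤ _ := sum_le_sum fun x _ => min_tensorFun_swap_ge hμ0 x l

/-! ## §2 Chapter R's gap from chapter Y's data -/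

variable (hμ : ∀ k x, 0 < μ k x) (hμ1 : ∀ k, ∑ x, μ k x = 1) (hmode : Function.Surjective mode)
  {M : Fin (K + 1) → S → S → ℝ}
include hμ hμ1 hmode

/-- **`Gap(ptBareSampler ½ μ M) ≥ p q^K γ_A·min{δ²pq/K², γ₀/(K+1)}/(96(K+1)²)`** from within-mode gaps `γ_A`, the hot
replica's GLOBAL gap `γ₀`, chapter Y's mode-restricted one-level overlaps `δ`, persistence `p` and cooling `q`
(`p, q, δ, γ_A ≤ 1`, `K ≥ 1`). [ours] -/
theorem ptBareModeHalf_spectralGap_ge_of_overlap [Nontrivial S] (hK : 1 ≤ K) (hM : ∀ k, IsRowStochastic (M k))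
    (hMrev : ∀ k, DetailedBalance (μ k) (M k))
    {p q δ γ₀ γA : ℝ} (hp : 0 < p) (hp1 : p ≤ 1) (hq0 : 0 < q) (hq1 : q ≤ 1) (hδ0 : 0 < δ) (hδ1 : δ ≤ 1)
    (hγ₀ : 0 < γ₀) (hγA : 0 < γA) (hγA1 : γA ≤ 1)
    (hpers : ∀ (i k : Fin (K + 1)) (j : J), i ≤ k → p * blockMass (μ k) mode j ≤ blockMass (μ i) mode j)
    (hq : ∀ (l : Fin K) (j : J), q * blockMass (μ l.castSucc) mode j ≤ blockMass (μ l.succ) mode j)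
    (hδ : ∀ (l : Fin K) (j : J), δ * min (blockMass (μ l.castSucc) mode j) (blockMass (μ l.succ) mode j)
      ≤ ∑ x ∈ block mode j, min (μ l.castSucc x) (μ l.succ x))
    (hgap0 : ∀ h : S → ℝ, γ₀ * lawVariance (μ 0) h ≤ dirichletForm (μ 0) (M 0) h)
    (hgapA : ∀ k j, ∀ h : S → ℝ, γA * lawVariance (blockLaw (μ k) mode j) h
      ≤ dirichletForm (blockLaw (μ k) mode j) (restrictionChain (M k) mode) h) :
    p * q ^ K * γA * min (δ ^ 2 * p * q / K ^ 2) (γ₀ / (K + 1)) / (96 * (K + 1) ^ 2)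
      ≤ spectralGap (tensorFun μ) (ptBareSampler (1 / 2) μ M) := by
  have hpers1 : ∀ (l : Fin K) (j : J), p * blockMass (μ l.succ) mode j ≤ blockMass (μ l.castSucc) mode j :=
    fun l j => hpers l.castSucc l.succ j (Fin.castSucc_lt_succ (i := l)).le
  have hδ2 : δ ^ 2 * p * q ≤ 1 := by
    have : δ ^ 2 ≤ 1 := by nlinarith
    calc δ ^ 2 * p * q ≤ 1 * 1 * 1 := by gcongr
      _ = 1 := by ring
  exact ptBareModeHalf_spectralGap_ge_of_hotGap hμ hμ1 hmode hK hM hMrev hp hp1 hq0 hq1 (by positivity) hδ2 hγ₀ hγA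
    hγA1 hpers hq (fun m l _ => ptBareMode_hδ_of_overlap (fun k x => (hμ k x).le) hδ0.le hp.le hp1 hq0.le hq1 hδ
      hpers1 hq m l) hgap0 hgapA

end Overlap

end Summit.Ventures.LatticeQCDFlow.Scaling
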